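/-
Copyright: the b2b-balaban T⁴-continuum CRUX team, row NE7b OWNER lineage `t4-ne7b-p1` (gen 148). Project licence.
-/
import Summits.QuantumFields.BalabanUV.T4Continuum.Spine.NE7b.SupWeightedClassPowerCounting

/-!
# THE ROLE-MAX LETTER: THE PER-ROLE ONE-STEP BOUNDS WITH CROSS TERMS ARE ONE AFFINE RECURSION FOR THE MAXIMUM OVER THE ROLES
# ((784) §3 ∕ (788) made honest about the roles; file (789)).  At order `m` the weighted class carries `m` slot letters (roles: which
# kernel index is fixed — (756)–(760) at order 5), and the one-step files ((773)∕(780)–(783)) bound the next letter of role `i` by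
# `T·(k_i + Σ_j a_ij·k_j + S_i)`: its own letter with unit coefficient, the OTHER roles' letters through the bookkeeping letters
# (`αk5m_j ≥ k5ϑ_j·αrσ`, …) with nonnegative coefficients, and a source.  (784)'s `readoff_affine` and (788)'s ball are stated for ONE
# letter `K`; THIS FILE justifies reading `K` as the MAXIMUM OVER THE ROLES: if `k_i ≤ K` for all roles, `Σ_j a_ij ≤ A`, `S_i ≤ S̄`, then
# every next role letter is `≤ T(1+A)·K + T·S̄`, so any common bound `K⁺` attained by a role (the max) obeys `K⁺ ≤ μK + C` with
# `μ = T(1+A)`, `C = T·S̄` — (436)'s recursion for the role-max, to which (784) `irrelevant_orbit` ∕ (788) apply verbatim (row NE7b, node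
# U5c; (784) BY NAME; Mathlib; [folklore] finite sums).

Cell `pub-balaban`, sub-cell `t4`, spine estimate NE7b (`T4WeightBudget.RelWeightBound`; the cell's OWN estimate — NOT PRINTED in
[Bałaban 1983–89], NOT PROVED).  Crux-route work under `Spine/NE7b/` by the row OWNER (`t4-ne7b-p1` gen 148, file (789)) under FREEZE
(0)'s crux-prover clause; NOTHING of Bałaban's is named as a Lean object, valued or asserted; no `T4Continuum/Support` leaf typed; no
`def`, no notation; zero `sorry`.  Imports (BY NAME): (784) `…SupWeightedClassPowerCounting` (`irrelevant_orbit`).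

WHAT IS PROVED ([folklore]; roles `Fin r`, letters `k k′ S : Fin r → ℝ`, cross coefficients `a : Fin r → Fin r → ℝ`):
* §1 `cross_sum_le` (`0 ≤ a`, `k ≤ K ⟹ Σ_j a_ij k_j ≤ (Σ_j a_ij)·K`), **`role_max_step`** (`k′_i ≤ T(k_i + Σ_j a_ij k_j + S_i)` for all `i`,
  `0 ≤ T`, `0 ≤ a`, `0 ≤ K`, `k ≤ K`, `Σ_j a_ij ≤ A`, `S ≤ S̄ ⟹ ∀ i, k′_i ≤ T(1+A)·K + T·S̄`).
* §2 **`role_max_recursion`** (along a tower `k : ℕ → Fin r → ℝ` with role-max bounds `K : ℕ → ℝ` — `k_j ≤ K_j` and `K_{j+1}` attained by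
  some role —: `K_{j+1} ≤ T(1+A)·K_j + T·S̄`), **`role_max_ball`** ((784) `irrelevant_orbit` for the role-max: invariant ball and attraction).
* §3 toy.

HONEST (what this is NOT).  Finite bookkeeping over the roles; the coefficients `a_ij` (h-letter × factor letters) and sources are data;
nothing on the relevant∕marginal orders; scalar skeleton ((A3), NC-NE7b-α UNRULED); nothing of Bałaban's asserted.  BY-NAME EFFECT ON THE
WALL: NONE.  NE7b NOT PRINTED ∕ NOT PROVED; spine PROVED 0∕9; rung (B)+1 — the programme's measures remain FINITE-torus statements; NOT the
mass gap, NOT Clay.  HONEST DEPENDENCY: continuum YM on T⁴ ⇐ BetaPertH ∧ nine spine estimates (0∕9 proved); BetaPertH ⇐ (D1) ∧ (D4) ∧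
CAP+tail; G-an2-4 gates asym, D1 and NE2∕3∕4.
-/

set_option autoImplicit false

namespace Summit.QuantumFields.BalabanUV.T4Continuum.NE7b.SupWeightedClassRoleMax

open Finset
open scoped BigOperators
open SupWeightedClassPowerCounting (irrelevant_orbit)

variable {r : ℕ}

/-! ## §1. One step for the role-max -/

/-- The cross terms of one role are at most `(Σ_j a_ij)·K` when every role letter is `≤ K` and the coefficients are nonnegative. [folklore] -/
theorem cross_sum_le {k : Fin r → ℝ} {a : Fin r → Fin r → ℝ} {K : ℝ} (ha : ∀ i j, 0 ≤ a i j) (hK : ∀ j, k j ≤ K) (i : Fin r) :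
    ∑ j, a i j * k j ≤ (∑ j, a i j) * K := by
  rw [Finset.sum_mul]
  exact Finset.sum_le_sum fun j _ => mul_le_mul_of_nonneg_left (hK j) (ha i j)

/-- **ONE STEP FOR THE ROLE-MAX**: per-role bounds `k′_i ≤ T·(k_i + Σ_j a_ij k_j + S_i)` with `T ≥ 0`, `a ≥ 0`, a common bound
`0 ≤ K` of the role letters, `Σ_j a_ij ≤ A` and `S_i ≤ S̄` give `k′_i ≤ T(1+A)·K + T·S̄` for every role. [folklore] -/
theorem role_max_step {k k' S : Fin r → ℝ} {a : Fin r → Fin r → ℝ} {T K A Sbar : ℝ} (hT : 0 ≤ T) (ha : ∀ i j, 0 ≤ a i j)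
    (hK0 : 0 ≤ K) (hK : ∀ j, k j ≤ K) (hA : ∀ i, ∑ j, a i j ≤ A) (hS : ∀ i, S i ≤ Sbar)
    (hstep : ∀ i, k' i ≤ T * (k i + ∑ j, a i j * k j + S i)) (i : Fin r) : k' i ≤ T * (1 + A) * K + T * Sbar := by
  have h1 : ∑ j, a i j * k j ≤ A * K :=
    (cross_sum_le ha hK i).trans (mul_le_mul_of_nonneg_right (hA i) hK0)
  have h2 : k i + ∑ j, a i j * k j + S i ≤ K + A * K + Sbar := by linarith [hK i, hS i]
  calc k' i ≤ T * (k i + ∑ j, a i j * k j + S i) := hstep i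
    _ ≤ T * (K + A * K + Sbar) := mul_le_mul_of_nonneg_left h2 hT
    _ = T * (1 + A) * K + T * Sbar := by ring

/-! ## §2. Along a tower: the role-max obeys (436)'s recursion, hence (784)'s ball -/

/-- **THE ROLE-MAX RECURSION ALONG A TOWER**: role letters `k_j : Fin r → ℝ` at every scale `j` with role-max bounds `K_j`
(`k_j i ≤ K_j`, `0 ≤ K_j`, and `K_{j+1}` attained: `K_{j+1} ≤ k_{j+1} i` for some role `i`), per-role one-step bounds with scale-free
`T, a, A` and sources `S_j i ≤ S̄` ⟹ `K_{j+1} ≤ T(1+A)·K_j + T·S̄`. [folklore] -/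
theorem role_max_recursion {k S : ℕ → Fin r → ℝ} {K : ℕ → ℝ} {a : Fin r → Fin r → ℝ} {T A Sbar : ℝ} (hT : 0 ≤ T)
    (ha : ∀ i j, 0 ≤ a i j) (hK0 : ∀ j, 0 ≤ K j) (hK : ∀ j i, k j i ≤ K j) (hKmax : ∀ j, ∃ i, K (j + 1) ≤ k (j + 1) i)
    (hA : ∀ i, ∑ j, a i j ≤ A) (hS : ∀ j i, S j i ≤ Sbar)
    (hstep : ∀ j i, k (j + 1) i ≤ T * (k j i + ∑ i', a i i' * k j i' + S j i)) :
    ∀ j, K (j + 1) ≤ T * (1 + A) * K j + T * Sbar := by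
  intro j
  obtain ⟨i, hi⟩ := hKmax j
  exact hi.trans (role_max_step hT ha (hK0 j) (hK j) hA (hS j) (hstep j) i)

/-- **THE ROLE-MAX STAYS IN (784)'S BALL**: under the recursion of `role_max_recursion` with `0 ≤ T(1+A) < 1`, `0 ≤ T·S̄`, a radius
`r ≥ T·S̄∕(1 − T(1+A))` with `K_0 ≤ r`: `K_j ≤ r` and `K_j ≤ (T(1+A))^j·K_0 + T·S̄∕(1 − T(1+A))` for all `j` — and with it every role letter.
[folklore] -/
theorem role_max_ball {k S : ℕ → Fin r → ℝ} {K : ℕ → ℝ} {a : Fin r → Fin r → ℝ} {T A Sbar rad : ℝ} (hT : 0 ≤ T)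
    (ha : ∀ i j, 0 ≤ a i j) (hK0 : ∀ j, 0 ≤ K j) (hK : ∀ j i, k j i ≤ K j) (hKmax : ∀ j, ∃ i, K (j + 1) ≤ k (j + 1) i)
    (hA : ∀ i, ∑ j, a i j ≤ A) (hS : ∀ j i, S j i ≤ Sbar)
    (hstep : ∀ j i, k (j + 1) i ≤ T * (k j i + ∑ i', a i i' * k j i' + S j i))
    (hμ0 : 0 ≤ T * (1 + A)) (hμ1 : T * (1 + A) < 1) (hC : 0 ≤ T * Sbar) (hrad : T * Sbar / (1 - T * (1 + A)) ≤ rad) (h0 : K 0 ≤ rad) :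
    ∀ j i, k j i ≤ rad ∧ k j i ≤ (T * (1 + A)) ^ j * K 0 + T * Sbar / (1 - T * (1 + A)) := by
  have hrec := role_max_recursion hT ha hK0 hK hKmax hA hS hstep
  have horbit := irrelevant_orbit hμ0 hμ1 hC hK0 hrec hrad h0
  intro j i
  exact ⟨(hK j i).trans (horbit j).1, (hK j i).trans (horbit j).2⟩

/-! ## §3. Toy -/

/-- Toy (kernel): two roles with letters `1, 2 ≤ K = 2`, cross coefficients `a ≡ 1∕4` (`A = 1∕2`), `T = 1∕2`, `S̄ = 1`: the next letters
are `≤ ½·(1 + ½)·2 + ½ = 2` — the role-max `2` is invariant. -/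
example : (1 / 2 : ℝ) * (1 + 1 / 2) * 2 + 1 / 2 * 1 = 2 := by norm_num

end Summit.QuantumFields.BalabanUV.T4Continuum.NE7b.SupWeightedClassRoleMax
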